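import Literature.Barriers.QuantumFields.FiniteTemperatureDeconfinement
import Summits.QuantumFields.YangMills.Theorems.IR.Negative.FixedMesh.LayerTwist

/-!
# Fixed-mesh negative for format T, part 3/6: the column, the staple, the data-adapted charged test, the rectangle loop

Part of the fixed-mesh negative for format T of crux `IR` (stmt-QuantumFields-19354, registered cut `af-pincer-T`
sha16 0308f95ca6f6a115); headline module `Theorems/IR/Negative/TypShellCondFalseFixedMesh.lean` (statement, provenance,
reading).  Content re-homed verbatim from the crux workfile `Cruxes/IR/CruxIdea8FixedMesh.lean` (cruxidea-8 GEN 5,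
tree sha16 d880b42bb52976de) under the namespace `Summit.QuantumFields.YangMills.Cruxes.IR.FixedMesh`; sorry-free.
-/

set_option autoImplicit false

noncomputable section

open MeasureTheory Filter Topology
open Literature.MathematicalPhysics.QuantumLattice
open Literature.Probability.LatticeModels
open Summit.QuantumFields.YangMills.Cruxes.IR.Tempered (cellEdges windowCells regionEdges)
open Summit.QuantumFields.YangMills.Cruxes.IR.ShellTempered (windowCellsPlus)
open Summit.QuantumFields.YangMills.Cruxes.IR.OnsetFormats (TypShellCond shellCount OnsetMixingTypical)

namespace Summit.QuantumFields.YangMills.Cruxes.IR.FixedMesh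

section FixedMesh

open Literature.MathematicalPhysics.QuantumFieldTheory (wilsonMeasure GaugeConfig isProbabilityMeasure_wilsonMeasure
  measurable_torusLift gaugeTransform wilsonMeasure_map_gaugeTransform_holds wilsonAction)

variable {G : Type} [Group G] [TopologicalSpace G] [IsTopologicalGroup G] [CompactSpace G]
  [SecondCountableTopology G] [MeasurableSpace G] [BorelSpace G]
  {N : ℕ} (ρ : G →* Matrix (Fin N) (Fin N) ℂ)


/-! ### 4a. The column, the staple, the data-adapted charged test, the rectangle loop -/

/-- The site `(t, s, 0, 0)`. -/
def site2 (t s : ℤ) : Site 4 := fun i => if i = 0 then t else if i = 1 then s else 0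

/-- The `0`-coordinate of `site2 t s` is `t`. -/
@[simp] theorem site2_zero (t s : ℤ) : site2 t s 0 = t := rfl

/-- The `1`-coordinate of `site2 t s` is `s`. -/
@[simp] theorem site2_one (t s : ℤ) : site2 t s 1 = s := rfl

/-- The cell-0 COLUMN `U(e₁) · U(e₂) ⋯ U(e_b)`, `e_t = ((t,0,0,0), 0)`: the transport along the time line of cell `0`
of the standard frame from height `1` to height `b + 1` (the factor `e₁`, the one twisted by `τ_1`, separated). -/
def col (b : ℕ) (U : LGConfig 4 G) : G :=
  U (site2 1 0, 0) * ((List.range (b - 1)).map fun i : ℕ => U (site2 ((i : ℤ) + 2) 0, 0)).prod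

/-- The STAPLE closing the column into the boundary of the rectangle `[0, b+1] × [0, m]` of the `(0,1)`-plane:
top run at height `b + 1` (`m` links, forward), down run at `x₁ = m` (`b + 1` links, backward), bottom run at
height `0` (`m` links, backward), and the closing link `((0,0,0,0), 0)` (forward) back to the column's foot
`(1,0,0,0)`.  `col U * staple U` is the holonomy of the closed contractible lattice rectangle based at `(1,0,0,0)`. -/
def staple (b m : ℕ) (U : LGConfig 4 G) : G :=
  ((List.range m).map fun s : ℕ => U (site2 ((b : ℤ) + 1) s, 1)).prod *
    ((((List.range (b + 1)).reverse).map fun t : ℕ => (U (site2 t m, 0))⁻¹).prod *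
      ((((List.range m).reverse).map fun s : ℕ => (U (site2 0 s, 1))⁻¹).prod * U (site2 0 0, 0)))

/-- The DATA-ADAPTED CHARGED TEST: the column of `U` closed by the staple READ OFF THE DATUM `ζ` (a fixed group
element): `g_ζ(U) = tr ρ(col_b(U) · staple_{b,m}(ζ)) / N`. -/
def chargedTest (b m : ℕ) (ζ U : LGConfig 4 G) : ℂ := (ρ (col b U * staple b m ζ)).trace / N

/-- The rectangle WILSON LOOP observable `W(U) = Re tr ρ(col_b(U) · staple_{b,m}(U)) / N`. -/
def loopObs (b m : ℕ) (U : LGConfig 4 G) : ℝ := (chargedTest ρ b m U U).re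

/-- Edges read by the column. -/
def colEdges (b : ℕ) : Finset (ZdEdge 4) :=
  {(site2 1 0, (0 : Fin 4))} ∪ (Finset.range (b - 1)).image fun i : ℕ => (site2 ((i : ℤ) + 2) 0, (0 : Fin 4))

/-- Edges read by the staple. -/
def stapleEdges (b m : ℕ) : Finset (ZdEdge 4) :=
  ((Finset.range m).image fun s : ℕ => (site2 ((b : ℤ) + 1) s, (1 : Fin 4))) ∪
    ((Finset.range (b + 1)).image fun t : ℕ => (site2 t m, (0 : Fin 4))) ∪
      ((Finset.range m).image fun s : ℕ => (site2 0 s, (1 : Fin 4))) ∪ {(site2 0 0, (0 : Fin 4))}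

/-- Edges read by the loop. -/
def loopEdges (b m : ℕ) : Finset (ZdEdge 4) := colEdges b ∪ stapleEdges b m

/-! ### 4b. Algebra: congruence, charge, bounds, continuity (PROVED) -/

omit [TopologicalSpace G] [IsTopologicalGroup G] [CompactSpace G] [SecondCountableTopology G]
  [MeasurableSpace G] [BorelSpace G] in
/-- The column depends only on the links of `colEdges b`. -/
theorem col_congr {b : ℕ} {U U' : LGConfig 4 G} (h : ∀ e ∈ colEdges b, U e = U' e) : col b U = col b U' := by
  unfold col
  have h1 : U (site2 1 0, 0) = U' (site2 1 0, 0) :=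
    h _ (Finset.mem_union_left _ (Finset.mem_singleton_self _))
  have h2 : ((List.range (b - 1)).map fun i : ℕ => U (site2 ((i : ℤ) + 2) 0, 0)) =
      (List.range (b - 1)).map fun i : ℕ => U' (site2 ((i : ℤ) + 2) 0, 0) := by
    refine List.map_congr_left fun i hi => h _ (Finset.mem_union_right _ ?_)
    exact Finset.mem_image.2 ⟨i, by simpa using hi, rfl⟩
  rw [h1, h2]

omit [TopologicalSpace G] [IsTopologicalGroup G] [CompactSpace G] [SecondCountableTopology G]
  [MeasurableSpace G] [BorelSpace G] in
/-- The staple depends only on the links of `stapleEdges b m`. -/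
theorem staple_congr {b m : ℕ} {U U' : LGConfig 4 G} (h : ∀ e ∈ stapleEdges b m, U e = U' e) :
    staple b m U = staple b m U' := by
  unfold staple
  have htop : ((List.range m).map fun s : ℕ => U (site2 ((b : ℤ) + 1) s, 1)) =
      (List.range m).map fun s : ℕ => U' (site2 ((b : ℤ) + 1) s, 1) := by
    refine List.map_congr_left fun s hs => h _ ?_
    simp only [stapleEdges, Finset.mem_union, Finset.mem_image, Finset.mem_range, Finset.mem_singleton]
    exact Or.inl (Or.inl (Or.inl ⟨s, by simpa using hs, rfl⟩))
  have hdown : (((List.range (b + 1)).reverse).map fun t : ℕ => (U (site2 t m, 0))⁻¹) =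
      ((List.range (b + 1)).reverse).map fun t : ℕ => (U' (site2 t m, 0))⁻¹ := by
    refine List.map_congr_left fun t ht => ?_
    rw [h _ ?_]
    simp only [stapleEdges, Finset.mem_union, Finset.mem_image, Finset.mem_range, Finset.mem_singleton]
    exact Or.inl (Or.inl (Or.inr ⟨t, by simpa using ht, rfl⟩))
  have hbot : (((List.range m).reverse).map fun s : ℕ => (U (site2 0 s, 1))⁻¹) =
      ((List.range m).reverse).map fun s : ℕ => (U' (site2 0 s, 1))⁻¹ := by
    refine List.map_congr_left fun s hs => ?_
    rw [h _ ?_]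
    simp only [stapleEdges, Finset.mem_union, Finset.mem_image, Finset.mem_range, Finset.mem_singleton]
    exact Or.inl (Or.inr ⟨s, by simpa using hs, rfl⟩)
  have hclose : U (site2 0 0, 0) = U' (site2 0 0, 0) := h _ (by simp [stapleEdges])
  rw [htop, hdown, hbot, hclose]

omit [TopologicalSpace G] [IsTopologicalGroup G] [CompactSpace G] [SecondCountableTopology G]
  [MeasurableSpace G] [BorelSpace G] in
/-- **PROVED.** The loop observable is a cylinder on `loopEdges`. -/
theorem loopObs_isCylinder (b m : ℕ) : IsCylinder (loopObs ρ b m) (loopEdges b m) := by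
  intro U U' hUU'
  have hc : col b U = col b U' :=
    col_congr fun e he => hUU' e (Finset.mem_coe.2 (Finset.mem_union_left _ he))
  have hs : staple b m U = staple b m U' :=
    staple_congr fun e he => hUU' e (Finset.mem_coe.2 (Finset.mem_union_right _ he))
  simp only [loopObs, chargedTest, hc, hs]

omit [TopologicalSpace G] [IsTopologicalGroup G] [CompactSpace G] [SecondCountableTopology G]
  [MeasurableSpace G] [BorelSpace G] in
/-- **PROVED.** `τ_1` multiplies the column by the central `g₀`. -/
theorem col_layerTwist_one (g₀ : G) (b : ℕ) (U : LGConfig 4 G) :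
    col b (layerTwist 1 g₀ U) = g₀ * col b U := by
  unfold col
  have h1 : layerTwist 1 g₀ U (site2 1 0, 0) = g₀ * U (site2 1 0, 0) := by
    simp [layerTwist, site2]
  have h2 : ((List.range (b - 1)).map fun i : ℕ => layerTwist 1 g₀ U (site2 ((i : ℤ) + 2) 0, 0)) =
      (List.range (b - 1)).map fun i : ℕ => U (site2 ((i : ℤ) + 2) 0, 0) := by
    refine List.map_congr_left fun i _ => ?_
    have : ¬ ((i : ℤ) + 2 = 1) := by omega
    simp [layerTwist, site2, this]
  rw [h1, h2, mul_assoc]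

omit [TopologicalSpace G] [IsTopologicalGroup G] [CompactSpace G] [SecondCountableTopology G]
  [MeasurableSpace G] [BorelSpace G] in
/-- **PROVED.** The data-adapted test has charge `c` under `τ_1` when `ρ g₀ = c • 1` (no centrality needed:
the twisted link is the FIRST factor of the column). -/
theorem chargedTest_layerTwist {g₀ : G} {c : ℂ}
    (hρc : ρ g₀ = c • (1 : Matrix (Fin N) (Fin N) ℂ)) (b m : ℕ) (ζ U : LGConfig 4 G) :
    chargedTest ρ b m ζ (layerTwist 1 g₀ U) = c * chargedTest ρ b m ζ U := by
  unfold chargedTest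
  rw [col_layerTwist_one g₀, mul_assoc, map_mul, hρc, smul_mul_assoc, one_mul, Matrix.trace_smul,
    smul_eq_mul, mul_div_assoc]

omit [TopologicalSpace G] [IsTopologicalGroup G] [CompactSpace G] [SecondCountableTopology G]
  [MeasurableSpace G] [BorelSpace G] in
/-- The vertical links `(site2 t 0, 0)`, `1 ≤ t ≤ b`, lie in the edge set of cell `0` of the standard frame. -/
theorem site2_mem_cellEdges_zero {b : ℕ} {t : ℤ} (ht : 1 ≤ t ∧ t ≤ (b : ℤ)) :
    (site2 t 0, (0 : Fin 4)) ∈ cellEdges (stdFrame b) 0 := by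
  refine Finset.mem_product.2 ⟨Fintype.mem_piFinset.2 fun i => ?_, Finset.mem_univ _⟩
  simp only [site2, stdFrame, Pi.zero_apply, Finset.mem_Ico, mul_zero, zero_add, mul_one]
  have h10 : (1 : Fin 4) ≠ 0 := by decide
  by_cases hi : i = 0
  · subst hi; simp; omega
  · by_cases hi1 : i = 1
    · subst hi1; simp [h10]; omega
    · simp [hi, hi1]; omega

omit [TopologicalSpace G] [IsTopologicalGroup G] [CompactSpace G] [SecondCountableTopology G]
  [MeasurableSpace G] [BorelSpace G] in
/-- The column edges lie in cell `0` of the standard mesh-`b` frame (`b ≥ 1`). -/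
theorem colEdges_subset_cellEdges {b : ℕ} (hb : 1 ≤ b) : colEdges b ⊆ cellEdges (stdFrame b) 0 := by
  intro e he
  rcases Finset.mem_union.1 he with he | he
  · rw [Finset.mem_singleton] at he
    subst he
    exact site2_mem_cellEdges_zero ⟨le_rfl, by exact_mod_cast hb⟩
  · obtain ⟨i, hi, rfl⟩ := Finset.mem_image.1 he
    rw [Finset.mem_range] at hi
    exact site2_mem_cellEdges_zero ⟨by omega, by omega⟩

omit [TopologicalSpace G] [IsTopologicalGroup G] [CompactSpace G] [SecondCountableTopology G]
  [MeasurableSpace G] [BorelSpace G] in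
/-- **PROVED.** The charged test is a cylinder on the centre cell's edges (for each fixed datum `ζ`). -/
theorem chargedTest_isCylinder {b : ℕ} (hb : 1 ≤ b) (m : ℕ) (ζ : LGConfig 4 G) :
    IsCylinder (chargedTest ρ b m ζ) (cellEdges (stdFrame b) 0) := by
  intro U U' hUU'
  have hc : col b U = col b U' :=
    col_congr fun e he => hUU' e (Finset.mem_coe.2 (colEdges_subset_cellEdges hb he))
  simp only [chargedTest, hc]

omit [TopologicalSpace G] [IsTopologicalGroup G] [CompactSpace G] [SecondCountableTopology G]
  [MeasurableSpace G] [BorelSpace G] in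
/-- `‖tr ρ(x) / N‖ ≤ 1` for a unitary representation. -/
theorem norm_trace_div_le (hρu : ∀ g, ρ g ∈ Matrix.unitaryGroup (Fin N) ℂ) (x : G) :
    ‖(ρ x).trace / (N : ℂ)‖ ≤ 1 := by
  have h := Literature.Barriers.QuantumFields.FiniteTemperature.norm_trace_le_of_mem_unitaryGroup (hρu x)
  rw [norm_div, Complex.norm_natCast]
  by_cases hN : (N : ℝ) = 0
  · rw [hN, div_zero]; exact zero_le_one
  · rwa [div_le_one (lt_of_le_of_ne (Nat.cast_nonneg N) (Ne.symm hN))]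

omit [TopologicalSpace G] [IsTopologicalGroup G] [CompactSpace G] [SecondCountableTopology G]
  [MeasurableSpace G] [BorelSpace G] in
/-- **PROVED.** `‖g_ζ(U)‖ ≤ 1`. -/
theorem norm_chargedTest_le (hρu : ∀ g, ρ g ∈ Matrix.unitaryGroup (Fin N) ℂ) (b m : ℕ)
    (ζ U : LGConfig 4 G) : ‖chargedTest ρ b m ζ U‖ ≤ 1 :=
  norm_trace_div_le ρ hρu _

omit [TopologicalSpace G] [IsTopologicalGroup G] [CompactSpace G] [SecondCountableTopology G]
  [MeasurableSpace G] [BorelSpace G] in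
/-- **PROVED.** `|W(U)| ≤ 1`. -/
theorem abs_loopObs_le (hρu : ∀ g, ρ g ∈ Matrix.unitaryGroup (Fin N) ℂ) (b m : ℕ) (U : LGConfig 4 G) :
    |loopObs ρ b m U| ≤ 1 :=
  (Complex.abs_re_le_norm _).trans (norm_chargedTest_le ρ hρu b m U U)

omit [CompactSpace G] [SecondCountableTopology G] [MeasurableSpace G] [BorelSpace G] in
/-- The column is a continuous function of the configuration. -/
theorem continuous_col (b : ℕ) : Continuous (col (G := G) b) := by
  unfold col
  exact (continuous_apply _).mul
    (continuous_list_prod (f := fun (i : ℕ) (U : LGConfig 4 G) => U (site2 ((i : ℤ) + 2) 0, 0)) _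
      fun i _ => continuous_apply _)

omit [CompactSpace G] [SecondCountableTopology G] [MeasurableSpace G] [BorelSpace G] in
/-- The staple is a continuous function of the configuration. -/
theorem continuous_staple (b m : ℕ) : Continuous (staple (G := G) b m) := by
  unfold staple
  refine (continuous_list_prod (f := fun (s : ℕ) (U : LGConfig 4 G) => U (site2 ((b : ℤ) + 1) s, 1)) _
      fun s _ => continuous_apply _).mul ((continuous_list_prod
        (f := fun (t : ℕ) (U : LGConfig 4 G) => (U (site2 t m, 0))⁻¹) _
          fun t _ => (continuous_apply _).inv).mul ((continuous_list_prod
            (f := fun (s : ℕ) (U : LGConfig 4 G) => (U (site2 0 s, 1))⁻¹) _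
              fun s _ => (continuous_apply _).inv).mul (continuous_apply _)))

omit [CompactSpace G] [SecondCountableTopology G] [MeasurableSpace G] [BorelSpace G] in
/-- The charged test is continuous in the configuration (fixed datum). -/
theorem continuous_chargedTest (hρ : Continuous ρ) (b m : ℕ) (ζ : LGConfig 4 G) :
    Continuous (chargedTest ρ b m ζ) := by
  unfold chargedTest
  exact ((hρ.comp ((continuous_col b).mul continuous_const)).matrix_trace).div_const _

omit [CompactSpace G] [SecondCountableTopology G] [MeasurableSpace G] [BorelSpace G] in
/-- The rectangle loop observable is continuous. -/
theorem continuous_loopObs (hρ : Continuous ρ) (b m : ℕ) : Continuous (loopObs ρ b m) := by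
  unfold loopObs chargedTest
  exact Complex.continuous_re.comp
    (((hρ.comp ((continuous_col b).mul (continuous_staple b m))).matrix_trace).div_const _)

omit [CompactSpace G] in
/-- The charged test is measurable in the configuration (fixed datum). -/
theorem measurable_chargedTest (hρ : Continuous ρ) (b m : ℕ) (ζ : LGConfig 4 G) :
    Measurable (chargedTest ρ b m ζ) :=
  (continuous_chargedTest ρ hρ b m ζ).measurable


end FixedMesh

end Summit.QuantumFields.YangMills.Cruxes.IR.FixedMesh

end
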